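import Mathlib
import HarnessLib
import Summits.Ventures.LatticeQCDFlow.Exactness.SU2ExactForceRegularUniform
import Summits.Ventures.LatticeQCDFlow.Exactness.SU2WilsonFlowLOMemberFTHMCN
import Summits.Ventures.LatticeQCDFlow.Exactness.SU2LeapfrogHMCWilson

/-!
# VOLUME-UNIFORMITY: the exact force through the `SU(2)` LO Wilson-flow member is bounded and Lipschitz with constants that do NOT depend on the lattice side, and multi-step FT-HMC with the exact force as run converges below ONE trajectory-length threshold `τ₀` for EVERY volume

HONEST FRAMING: exact (Metropolis-corrected) sampling algorithms for lattice gauge theory;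
figures of merit are autocorrelation/cost numbers at stated couplings and volumes; no
continuum-physics claim.

Venture `LatticeQCDFlow` (cell pub-lqcd), topic `Exactness`; FANOUT row 14 (`eng-flowhmc`, engine
`latflow.fthmc`, family B: FT-HMC through the LO Wilson-flow member on `SU(2)` with the exact autodiff
force, row 9's `n`-step Pauli-drift kernel `su2LeapfrogHMCN`).  NEW WORK of the cell over the tree
(`SU2ExactForceRegularUniform`: §1 below — the volume-free `Φ_max`, `K_Φ` (GEN-17 split: the regularity
half is its own file); `SU2WilsonFlowLOMemberFTHMCN` (GEN-14): the member package;
`SUNMultiStepLeapfrogFTHMCErgodic` (GEN-14): the multi-step convergence theorem and its threshold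
`sunShortTrajThreshold pauliCoordι`, which depends on the COORDINATES only; `SU2LeapfrogHMCWilson`:
`su2GibbsLaw = wilsonMeasure`); nothing is cited as a fact; no number.  Ninth and last file of the
VOLUME-UNIFORMITY chain (GEN-15); it CLOSES the NOT-CLAIMED item of GEN-14
(`SU2WilsonFlowLOExactForceRegular` / `…FTHMCN`: "constants uniform in the volume — not claimed, not
expected from this argument").  Masks = the engine's phase masks `x ↦ Σᵢ xᵢ mod w` (`w ∣ L`; parity:
`w = 2`), written VERBATIM as `ZMod.castHom hwL (ZMod w) (∑ j, x j)`.

* (`LatticeForceVolumeUniform`: `phaseMask_proper` (`w > 1`), `phaseMask_pull` — phase masks are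
  compatible with every covering `ℤ/M → ℤ/L`, `L ∣ M`);
* (`SUNMultiStepLeapfrogFTHMCErgodic.su2LeapfrogFTHMCN_uniformlyErgodic_of_trajLength_uniform`, appended
  there by this chain: the trajectory-length form of the multi-step convergence theorem with
  `τ₀ = τ₀(Φ_max, K_Φ)` chosen BEFORE the link type — one `τ₀` serves every finite link set);
* §1 (in `SU2ExactForceRegularUniform`) **`su2WilsonFlowLO_exactForce_regular_uniform`** — for the schedule `sched` of phase-masked LO
  sub-steps (`2(d−1)|ε| < 1`), every `β, κ`: THERE ARE `Φ_max, K_Φ ≥ 0` SUCH THAT FOR EVERY SIDE `L` with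
  `w ∣ L` and every `layers` packaged VERBATIM as in `exists_layers_su2WilsonFlowLO` (positive densities)
  the exact force is measurable, `‖Φ_κ(V)_l‖ ≤ Φ_max`, `‖Φ_κ(V) − Φ_κ(V')‖ ≤ K_Φ‖V − V'‖_∞`;
* §2 **`su2WilsonFlowLO_member_fthmcN_exactForce_uniformlyErgodic_allVolumes`** — THERE IS `τ₀ > 0`
  (depending on `d, w, ε, sched, β, κ, κ'` ONLY) SUCH THAT FOR EVERY SIDE `L` with `w ∣ L`: the member
  exists (layers VERBATIM), its exact force is measurable, and for every `n ≥ 1`, `ε' > 0` with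
  `nε' ≤ τ₀` the reported `n`-step FT-HMC kernel driven by `−(ε'/2)Φ_κ` converges to
  `wilsonMeasure SU(2).subtype β` from EVERY initial law, geometrically in total variation.

NOT CLAIMED: the VALUE of `τ₀` (compactness on the reference torus of side `w(4K+5)`; no number); that
the RATE `δ`, `k` is volume-uniform (it is not: Doeblin constants degrade with the volume — only the
THRESHOLD is uniform); longer trajectories; OMF; the learned residual members; floating point.
-/

noncomputable section

namespace Summit.Ventures.LatticeQCDFlow.Exactness

open Set Function MeasureTheory ProbabilityTheory ProbabilityTheory.Kernel InnerProductGeometry WithLp NormedSpace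
open Literature.MathematicalPhysics.QuantumFieldTheory
open Literature.MathematicalPhysics.QuantumFieldTheory.Balaban1983to89.B10Eq18SigmaSU2Haar (expPauli)
open scoped ENNReal Matrix Matrix.Norms.Operator NNReal

set_option backward.isDefEq.respectTransparency false

section Uniform

variable {d : ℕ}

/-! ## §2 One trajectory-length threshold for every volume -/

set_option maxHeartbeats 400000 in -- RN-23 (7)(b): heavy declaration budgeted at source (lake build ≈ 10 % hungrier than the gate)
/-- **MULTI-STEP FT-HMC THROUGH THE `SU(2)` LO WILSON-FLOW MEMBER WITH THE EXACT FORCE AS RUN CONVERGES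
BELOW ONE TRAJECTORY-LENGTH THRESHOLD FOR EVERY VOLUME.**  Phase masks of width `w > 1` (parity:
`w = 2`), refusal rule `2(d−1)|ε| < 1`, ANY schedule, every `β, κ`, `κ' > 0`: THERE IS `τ₀ > 0` such
that FOR EVERY side `L` with `w ∣ L`: there are `layers` (VERBATIM: the masked LO sub-steps of the
schedule with their booked densities) whose exact force `Φ_κ` is measurable, and for every `n ≥ 1`,
`ε' > 0` with `nε' ≤ τ₀` the reported `n`-step kernel
`conjKernel (su2LeapfrogHMCN ε' κ' (−(ε'/2)Φ_κ) (βS_W∘F − log J) n) F` converges to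
`wilsonMeasure SU(2).subtype β` from EVERY initial law, geometrically in total variation. -/
theorem su2WilsonFlowLO_member_fthmcN_exactForce_uniformlyErgodic_allVolumes (w : ℕ) [Fact (1 < w)]
    {ε : ℝ} (hε : |ε| * (2 * ((d - 1 : ℕ) : ℝ)) < 1) (sched : List (Fin d × ZMod w)) (β κ : ℝ)
    {κ' : ℝ} (hκ' : 0 < κ') :
    ∃ τ₀ : ℝ, 0 < τ₀ ∧ ∀ (L : ℕ) [NeZero L] (hwL : w ∣ L),
    ∃ layers : List ((GaugeConfig d L (Matrix.specialUnitaryGroup (Fin 2) ℂ) ≃ᵐ GaugeConfig d L (Matrix.specialUnitaryGroup (Fin 2) ℂ)) × (GaugeConfig d L (Matrix.specialUnitaryGroup (Fin 2) ℂ) → ℝ)),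
      layers.map (fun Ly => ((Ly.1 : GaugeConfig d L (Matrix.specialUnitaryGroup (Fin 2) ℂ) → GaugeConfig d L (Matrix.specialUnitaryGroup (Fin 2) ℂ)), Ly.2)) =
        sched.map (fun s =>
        ((fun (V : GaugeConfig d L (Matrix.specialUnitaryGroup (Fin 2) ℂ)) (e : Edge d L) =>
        if e.2 = s.1 ∧ (ZMod.castHom hwL (ZMod w) (∑ j, e.1 j)) = s.2 then
          gaussUnit (geodesicKick ε (∑ ν ∈ Finset.univ.erase e.2,
            (vecQuat (((V (Site.shift e.1 e.2, ν) * (V (Site.shift e.1 ν, e.2))⁻¹ * (V (e.1, ν))⁻¹)⁻¹ : (Matrix.specialUnitaryGroup (Fin 2) ℂ)) : Matrix (Fin 2) (Fin 2) ℂ) +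
              vecQuat ((((V (Site.shift (e.1 - Pi.single ν 1) e.2, ν))⁻¹ * (V (e.1 - Pi.single ν 1, e.2))⁻¹ *
                V (e.1 - Pi.single ν 1, ν))⁻¹ : (Matrix.specialUnitaryGroup (Fin 2) ℂ)) : Matrix (Fin 2) (Fin 2) ℂ)))
            (vecQuat ((V e : (Matrix.specialUnitaryGroup (Fin 2) ℂ)) : Matrix (Fin 2) (Fin 2) ℂ)))
        else V e),
         fun V : GaugeConfig d L (Matrix.specialUnitaryGroup (Fin 2) ℂ) => ∏ a : {e : Edge d L // e.2 = s.1 ∧ (ZMod.castHom hwL (ZMod w) (∑ j, e.1 j)) = s.2},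
          (if Real.sin (angle (∑ ν ∈ Finset.univ.erase a.1.2,
            (vecQuat (((V (Site.shift a.1.1 a.1.2, ν) * (V (Site.shift a.1.1 ν, a.1.2))⁻¹ * (V (a.1.1, ν))⁻¹)⁻¹ : (Matrix.specialUnitaryGroup (Fin 2) ℂ)) : Matrix (Fin 2) (Fin 2) ℂ) +
              vecQuat ((((V (Site.shift (a.1.1 - Pi.single ν 1) a.1.2, ν))⁻¹ * (V (a.1.1 - Pi.single ν 1, a.1.2))⁻¹ *
                V (a.1.1 - Pi.single ν 1, ν))⁻¹ : (Matrix.specialUnitaryGroup (Fin 2) ℂ)) : Matrix (Fin 2) (Fin 2) ℂ))) (vecQuat ((V a.1 : (Matrix.specialUnitaryGroup (Fin 2) ℂ)) : Matrix (Fin 2) (Fin 2) ℂ))) = 0 then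
            (1 - ε * ‖(∑ ν ∈ Finset.univ.erase a.1.2,
            (vecQuat (((V (Site.shift a.1.1 a.1.2, ν) * (V (Site.shift a.1.1 ν, a.1.2))⁻¹ * (V (a.1.1, ν))⁻¹)⁻¹ : (Matrix.specialUnitaryGroup (Fin 2) ℂ)) : Matrix (Fin 2) (Fin 2) ℂ) +
              vecQuat ((((V (Site.shift (a.1.1 - Pi.single ν 1) a.1.2, ν))⁻¹ * (V (a.1.1 - Pi.single ν 1, a.1.2))⁻¹ *
                V (a.1.1 - Pi.single ν 1, ν))⁻¹ : (Matrix.specialUnitaryGroup (Fin 2) ℂ)) : Matrix (Fin 2) (Fin 2) ℂ)))‖ * Real.cos (angle (∑ ν ∈ Finset.univ.erase a.1.2,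
            (vecQuat (((V (Site.shift a.1.1 a.1.2, ν) * (V (Site.shift a.1.1 ν, a.1.2))⁻¹ * (V (a.1.1, ν))⁻¹)⁻¹ : (Matrix.specialUnitaryGroup (Fin 2) ℂ)) : Matrix (Fin 2) (Fin 2) ℂ) +
              vecQuat ((((V (Site.shift (a.1.1 - Pi.single ν 1) a.1.2, ν))⁻¹ * (V (a.1.1 - Pi.single ν 1, a.1.2))⁻¹ *
                V (a.1.1 - Pi.single ν 1, ν))⁻¹ : (Matrix.specialUnitaryGroup (Fin 2) ℂ)) : Matrix (Fin 2) (Fin 2) ℂ))) (vecQuat ((V a.1 : (Matrix.specialUnitaryGroup (Fin 2) ℂ)) : Matrix (Fin 2) (Fin 2) ℂ)))) ^ 3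
          else kickJac (ε * ‖(∑ ν ∈ Finset.univ.erase a.1.2,
            (vecQuat (((V (Site.shift a.1.1 a.1.2, ν) * (V (Site.shift a.1.1 ν, a.1.2))⁻¹ * (V (a.1.1, ν))⁻¹)⁻¹ : (Matrix.specialUnitaryGroup (Fin 2) ℂ)) : Matrix (Fin 2) (Fin 2) ℂ) +
              vecQuat ((((V (Site.shift (a.1.1 - Pi.single ν 1) a.1.2, ν))⁻¹ * (V (a.1.1 - Pi.single ν 1, a.1.2))⁻¹ *
                V (a.1.1 - Pi.single ν 1, ν))⁻¹ : (Matrix.specialUnitaryGroup (Fin 2) ℂ)) : Matrix (Fin 2) (Fin 2) ℂ)))‖) 2 (angle (∑ ν ∈ Finset.univ.erase a.1.2,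
            (vecQuat (((V (Site.shift a.1.1 a.1.2, ν) * (V (Site.shift a.1.1 ν, a.1.2))⁻¹ * (V (a.1.1, ν))⁻¹)⁻¹ : (Matrix.specialUnitaryGroup (Fin 2) ℂ)) : Matrix (Fin 2) (Fin 2) ℂ) +
              vecQuat ((((V (Site.shift (a.1.1 - Pi.single ν 1) a.1.2, ν))⁻¹ * (V (a.1.1 - Pi.single ν 1, a.1.2))⁻¹ *
                V (a.1.1 - Pi.single ν 1, ν))⁻¹ : (Matrix.specialUnitaryGroup (Fin 2) ℂ)) : Matrix (Fin 2) (Fin 2) ℂ))) (vecQuat ((V a.1 : (Matrix.specialUnitaryGroup (Fin 2) ℂ)) : Matrix (Fin 2) (Fin 2) ℂ)))))) ∧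
      ∃ hΦ : Measurable (fun (V : GaugeConfig d L (Matrix.specialUnitaryGroup (Fin 2) ℂ)) (l : Edge d L) => κ • WithLp.toLp 2 (fun i : Fin 3 =>
        fderiv ℝ (fun a : Edge d L → EuclideanSpace ℝ (Fin 3) => β * wilsonAction (Matrix.specialUnitaryGroup (Fin 2) ℂ).subtype ((layers.foldr (fun Ly (F : GaugeConfig d L (Matrix.specialUnitaryGroup (Fin 2) ℂ) ≃ᵐ GaugeConfig d L (Matrix.specialUnitaryGroup (Fin 2) ℂ)) => Ly.1.trans F) (MeasurableEquiv.refl (GaugeConfig d L (Matrix.specialUnitaryGroup (Fin 2) ℂ)))) ((fun l : Edge d L => expPauli (a l)) * V)) - Real.log ((layers.foldr (fun Ly K => fun v => Ly.2 v * K (Ly.1 v)) (fun _ => (1 : ℝ))) ((fun l : Edge d L => expPauli (a l)) * V))) 0 (Pi.single l (EuclideanSpace.single i (1 : ℝ))))),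
      ∀ (n : ℕ) (ε' : ℝ) (_hn : 1 ≤ n) (_hε' : 0 < ε'), n * ε' ≤ τ₀ →
        ∃ k : ℕ, ∃ δ : ℝ, 0 < δ ∧ δ ≤ 1 ∧ ∀ (μ₀ : Measure (GaugeConfig d L (Matrix.specialUnitaryGroup (Fin 2) ℂ))) [IsProbabilityMeasure μ₀] (t : ℕ) (A : Set (GaugeConfig d L (Matrix.specialUnitaryGroup (Fin 2) ℂ))),
          |((fun m : Measure (GaugeConfig d L (Matrix.specialUnitaryGroup (Fin 2) ℂ)) =>
                m.bind (conjKernel (su2LeapfrogHMCN ε' κ' (measurable_halfKick_su2 hΦ ε')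
                  (fun V : GaugeConfig d L (Matrix.specialUnitaryGroup (Fin 2) ℂ) => β * wilsonAction (Matrix.specialUnitaryGroup (Fin 2) ℂ).subtype ((layers.foldr (fun Ly (F : GaugeConfig d L (Matrix.specialUnitaryGroup (Fin 2) ℂ) ≃ᵐ GaugeConfig d L (Matrix.specialUnitaryGroup (Fin 2) ℂ)) => Ly.1.trans F) (MeasurableEquiv.refl (GaugeConfig d L (Matrix.specialUnitaryGroup (Fin 2) ℂ)))) V) - Real.log ((layers.foldr (fun Ly K => fun v => Ly.2 v * K (Ly.1 v)) (fun _ => (1 : ℝ))) V)) n) (layers.foldr (fun Ly (F : GaugeConfig d L (Matrix.specialUnitaryGroup (Fin 2) ℂ) ≃ᵐ GaugeConfig d L (Matrix.specialUnitaryGroup (Fin 2) ℂ)) => Ly.1.trans F) (MeasurableEquiv.refl (GaugeConfig d L (Matrix.specialUnitaryGroup (Fin 2) ℂ))))))^[t] μ₀).real A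
            - (wilsonMeasure (Matrix.specialUnitaryGroup (Fin 2) ℂ).subtype β).real A| ≤ (1 - δ) ^ (t / (k + 1)) := by
  obtain ⟨Φmax, KΦ, hΦ0, hK0, hreg⟩ := su2WilsonFlowLO_exactForce_regular_uniform (d := d) w hε sched β κ
  obtain ⟨τ₀, hτ₀, hconv⟩ := su2LeapfrogFTHMCN_uniformlyErgodic_of_trajLength_uniform hκ' hΦ0 hK0
  refine ⟨τ₀, hτ₀, fun L _ hwL => ?_⟩
  have hχ : ∀ (x : Site d L) (i : Fin d),
      ZMod.castHom hwL (ZMod w) (∑ j, (Site.shift x i) j) ≠ ZMod.castHom hwL (ZMod w) (∑ j, x j) :=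
    fun x i => phaseMask_proper hwL x i
  obtain ⟨layers, hmap, hpos, hfmeas, hfjac, hfold⟩ := su2WilsonFlowLO_member_package
    (fun x : Site d L => ZMod.castHom hwL (ZMod w) (∑ j, x j)) hχ hε sched
  refine ⟨layers, hmap, ?_⟩
  obtain ⟨hΦm, hb, hK⟩ := hreg L hwL layers hmap hpos
  refine ⟨hΦm, fun n ε' hn hε' hτ => ?_⟩
  have hm : 0 < 1 - |ε| * (2 * ((d - 1 : ℕ) : ℝ)) := by linarith
  have hρ : Continuous ⇑((Matrix.specialUnitaryGroup (Fin 2) ℂ).subtype) := continuous_subtype_val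
  have hSc : Continuous fun U : GaugeConfig d L (Matrix.specialUnitaryGroup (Fin 2) ℂ) =>
      β * wilsonAction (Matrix.specialUnitaryGroup (Fin 2) ℂ).subtype U :=
    continuous_smul_wilsonAction _ hρ β
  obtain ⟨s, hs⟩ := exists_bound_smul_wilsonAction (d := d) (L := L) (Matrix.specialUnitaryGroup (Fin 2) ℂ).subtype hρ β
  obtain ⟨k, δ, hδ0, hδ1, hbound⟩ := hconv (Edge d L) hΦm hb hK
    (S := fun U : GaugeConfig d L (Matrix.specialUnitaryGroup (Fin 2) ℂ) =>
      β * wilsonAction (Matrix.specialUnitaryGroup (Fin 2) ℂ).subtype U)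
    hSc.measurable hs (pow_pos (pow_pos hm _) _) (fun v => (hfold v).1) (fun v => (hfold v).2) hfmeas hfjac
    n ε' hn hε' hτ
  refine ⟨k, δ, hδ0, hδ1, fun μ₀ _ t A => ?_⟩
  rw [← su2GibbsLaw_eq_wilsonMeasure (d := d) (L := L) (Matrix.specialUnitaryGroup (Fin 2) ℂ).subtype β]
  exact hbound μ₀ t A

end Uniform

end Summit.Ventures.LatticeQCDFlow.Exactness
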